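import Summits.AtomisticToContinuum.Crystallization.Theorems.ExcessDecayLiouvilleHcpLiouvilleBlowdownDefs
import Summits.AtomisticToContinuum.Crystallization.Theorems.ExcessDecayLiouvilleEnergyIdentity
import Summits.AtomisticToContinuum.Crystallization.Theorems.ExcessDecayLiouvilleHcpLiouvilleBlowdownLinRows

/-!
# `ExcessDecayLiouville.HcpLiouville` (stmt-AtomisticToContinuum-9332), line `Sketch` v4: rows of a point force

Part H3d-I of stub `stub_green`, lead file.  For the point field `φ = δ_a ξ` on the sites `S` of an admissible datum
we compute the rows of the force-constant operator, `(L φ)(a) = Σ_{q ≠ a} K(a − q) ξ`, `(L φ)(p) = −K(a − p) ξ`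
(`p ≠ a`), show that `L φ` is an ADMISSIBLE right-hand side (its pairing with a test field `w` is
`Σ_{q≠a} ⟪K(a−q) ξ, w a − w q⟫`, bounded through the path bound `blowdown_pathSup`), and decompose it into the
absolutely convergent family of DIPOLES `(δ_a − δ_q)(K(a − q) ξ)`, `q ∈ S`.  With the self-reproduction and
countable-additivity clauses of `blowdown_greenSolve` this yields the identity
`δ_a ξ = Σ_q (G_a − G_q)(K(a−q) ξ)` used to control cross-sublattice dipoles.
All `[folklore]`; a `--supports` helper for item stmt-AtomisticToContinuum-9332, nothing here closes an item.
-/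

noncomputable section

namespace Summit.AtomisticToContinuum.Crystallization.Theorems.ExcessDecayLiouville

open scoped BigOperators Topology Classical InnerProductSpace RealInnerProductSpace
open Literature.MathematicalPhysics.StatisticalMechanics
open Summit.AtomisticToContinuum.Crystallization.Theses.ExcessDecayLiouville
open Summit.AtomisticToContinuum.Crystallization.Theorems.PhononStabilityNegative

namespace Blowdown

/-- `‖K(e) d‖ ≤ 38 ‖e‖⁻⁸ ‖d‖` for `‖e‖ ≥ 9/10`, CLM form. [folklore] -/
theorem norm_forceConst_apply_le' {e : EuclideanSpace ℝ (Fin 3)} (he : 9 / 10 ≤ ‖e‖) (d : EuclideanSpace ℝ (Fin 3)) :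
    ‖forceConst e d‖ ≤ 38 * (‖e‖⁻¹) ^ 8 * ‖d‖ := by
  rw [forceConst_apply]; exact norm_forceConst_apply_le he d

section

variable {t : Fin 2 → EuclideanSpace ℝ (Fin 3)} {A : EuclideanSpace ℝ (Fin 3) →L[ℝ] EuclideanSpace ℝ (Fin 3)}

/-! ## Kernel sums -/

/-- `Σ'_{q ≠ a} dist(q,a)⁻⁸ (1 + dist(a,q))` is bounded by a universal constant. [folklore] -/
theorem tsum_ker_weight_le (hA : Adm₀ A) (hI : Inner₀ t A) {a : EuclideanSpace ℝ (Fin 3)} (ha : a ∈ Sites₀ t A) :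
    Summable (fun q : Sites₀ t A => if (q : EuclideanSpace ℝ (Fin 3)) ≠ a then
        (dist (q : EuclideanSpace ℝ (Fin 3)) a)⁻¹ ^ 8 * (1 + dist a (q : EuclideanSpace ℝ (Fin 3))) else 0) ∧
      ∑' q : Sites₀ t A, (if (q : EuclideanSpace ℝ (Fin 3)) ≠ a then
        (dist (q : EuclideanSpace ℝ (Fin 3)) a)⁻¹ ^ 8 * (1 + dist a (q : EuclideanSpace ℝ (Fin 3))) else 0) ≤
        1024 / ((23 / 25 : ℝ) ^ 3 * (23 / 25 : ℝ) ^ 5) + 1024 / ((23 / 25 : ℝ) ^ 3 * (23 / 25 : ℝ) ^ 4) := by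
  have h8 := LevelOne.summable_far hA hI a (le_refl (23 / 25 : ℝ)) (k := 5) (by norm_num)
  have h7 := LevelOne.summable_far hA hI a (le_refl (23 / 25 : ℝ)) (k := 4) (by norm_num)
  have h8' := LevelOne.tsum_far_le hA hI a (le_refl (23 / 25 : ℝ)) (k := 5) (by norm_num)
  have h7' := LevelOne.tsum_far_le hA hI a (le_refl (23 / 25 : ℝ)) (k := 4) (by norm_num)
  have heq : ∀ q : Sites₀ t A, (if (q : EuclideanSpace ℝ (Fin 3)) ≠ a then
      (dist (q : EuclideanSpace ℝ (Fin 3)) a)⁻¹ ^ 8 * (1 + dist a (q : EuclideanSpace ℝ (Fin 3))) else 0) =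
      (if (23 / 25 : ℝ) ≤ dist (q : EuclideanSpace ℝ (Fin 3)) a then (dist (q : EuclideanSpace ℝ (Fin 3)) a)⁻¹ ^ (5 + 3) else 0) +
      (if (23 / 25 : ℝ) ≤ dist (q : EuclideanSpace ℝ (Fin 3)) a then (dist (q : EuclideanSpace ℝ (Fin 3)) a)⁻¹ ^ (4 + 3) else 0) := by
    intro q
    by_cases hq : (q : EuclideanSpace ℝ (Fin 3)) ≠ a
    · have hd : (23 / 25 : ℝ) ≤ dist (q : EuclideanSpace ℝ (Fin 3)) a := dist_sites_ge hA hI q.2 ha hq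
      have hd0 : 0 < dist (q : EuclideanSpace ℝ (Fin 3)) a := by linarith
      rw [if_pos hq, if_pos hd, if_pos hd, dist_comm a]
      have : (dist (q : EuclideanSpace ℝ (Fin 3)) a)⁻¹ ^ 8 * dist (q : EuclideanSpace ℝ (Fin 3)) a =
          (dist (q : EuclideanSpace ℝ (Fin 3)) a)⁻¹ ^ (4 + 3) := by
        rw [show (8 : ℕ) = (4 + 3) + 1 from rfl, pow_succ, mul_assoc, inv_mul_cancel₀ hd0.ne', mul_one]
      rw [← this]; ring
    · rw [if_neg hq]
      have : ¬ ((23 / 25 : ℝ) ≤ dist (q : EuclideanSpace ℝ (Fin 3)) a) := by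
        rw [not_not] at hq; rw [hq, dist_self]; norm_num
      simp only [if_neg this, add_zero]
  simp only [heq]
  exact ⟨h8.add h7, by rw [h8.tsum_add h7]; exact add_le_add h8' h7'⟩

/-! ## Rows of the point field `δ_a ξ` -/

/-- The off-diagonal vector family `q ↦ [q ≠ a] K(a−q) ξ` is summable. [folklore] -/
theorem summable_offdiag (hA : Adm₀ A) (hI : Inner₀ t A) {a : EuclideanSpace ℝ (Fin 3)} (ha : a ∈ Sites₀ t A)
    (ξ : EuclideanSpace ℝ (Fin 3)) :
    Summable (fun q : Sites₀ t A => (if (q : EuclideanSpace ℝ (Fin 3)) ≠ a then forceConst (a - q) ξ else 0)) := by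
  refine Summable.of_norm_bounded (((summable_inv_pow_eight_sites hA hI ha).mul_left (38 * ‖ξ‖))) fun q => ?_
  by_cases hq : (q : EuclideanSpace ℝ (Fin 3)) = a
  · simp [hq]
  · rw [if_pos hq, if_pos hq]
    have he : 9 / 10 ≤ ‖a - q‖ := by
      have := dist_sites_ge hA hI ha q.2 (Ne.symm hq); rw [dist_eq_norm] at this; linarith
    refine (norm_forceConst_apply_le' he ξ).trans (le_of_eq ?_)
    rw [dist_comm, dist_eq_norm]; ring

/-- **Rows of a point force.**  For `φ = δ_a ξ` (`a ∈ S`): the row at `a` is `Σ'_{q≠a} K(a−q) ξ`, the row at `p ≠ a` is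
`−K(a−p) ξ` (as `HasSum`s of the full row family `q ↦ K(p−q)(φ p − φ q)`). [folklore] -/
theorem single_rows (hA : Adm₀ A) (hI : Inner₀ t A) {a : EuclideanSpace ℝ (Fin 3)} (ha : a ∈ Sites₀ t A)
    (ξ : EuclideanSpace ℝ (Fin 3)) (p : Sites₀ t A) :
    HasSum (fun q : Sites₀ t A => forceConst ((p : EuclideanSpace ℝ (Fin 3)) - q)
        ((if (p : EuclideanSpace ℝ (Fin 3)) = a then ξ else 0) - (if (q : EuclideanSpace ℝ (Fin 3)) = a then ξ else 0)))
      (if (p : EuclideanSpace ℝ (Fin 3)) = a then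
        ∑' q : Sites₀ t A, (if (q : EuclideanSpace ℝ (Fin 3)) ≠ a then forceConst (a - q) ξ else 0)
      else -forceConst (a - p) ξ) := by
  by_cases hp : (p : EuclideanSpace ℝ (Fin 3)) = a
  · -- the row at `a`
    have hfam : (fun q : Sites₀ t A => forceConst ((p : EuclideanSpace ℝ (Fin 3)) - q)
        ((if (p : EuclideanSpace ℝ (Fin 3)) = a then ξ else 0) - (if (q : EuclideanSpace ℝ (Fin 3)) = a then ξ else 0))) =
        fun q : Sites₀ t A => (if (q : EuclideanSpace ℝ (Fin 3)) ≠ a then forceConst (a - q) ξ else 0) := by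
      funext q
      rw [if_pos hp, hp]
      by_cases hq : (q : EuclideanSpace ℝ (Fin 3)) = a
      · rw [if_pos hq, if_neg (not_not.2 hq), sub_self, map_zero]
      · rw [if_neg hq, if_pos hq, sub_zero]
    rw [hfam, if_pos hp]
    exact (summable_offdiag hA hI ha ξ).hasSum
  · -- the row at `p ≠ a`: a single term
    have hfam : (fun q : Sites₀ t A => forceConst ((p : EuclideanSpace ℝ (Fin 3)) - q)
        ((if (p : EuclideanSpace ℝ (Fin 3)) = a then ξ else 0) - (if (q : EuclideanSpace ℝ (Fin 3)) = a then ξ else 0))) =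
        fun q : Sites₀ t A => (if q = ⟨a, ha⟩ then -forceConst (a - p) ξ else 0) := by
      funext q
      rw [if_neg hp, zero_sub]
      by_cases hq : q = ⟨a, ha⟩
      · rw [if_pos hq, if_pos (by rw [hq]), map_neg, hq]
        show -(forceConst ((p : EuclideanSpace ℝ (Fin 3)) - a) ξ) = -(forceConst (a - p) ξ)
        rw [← forceConst_neg, neg_sub]
      · have hq' : (q : EuclideanSpace ℝ (Fin 3)) ≠ a := fun h => hq (Subtype.ext h)
        rw [if_neg hq, if_neg hq', neg_zero, map_zero]
    rw [hfam, if_neg hp]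
    exact hasSum_ite_eq _ _

/-- **The pairing of `L(δ_a ξ)` with a test field**: `Σ'_p ⟪(Lφ)(p), w p⟫ = Σ'_{q ≠ a} ⟪K(a−q) ξ, w a − w q⟫` for
finitely supported `w`. [folklore] -/
theorem single_rows_pairing (hA : Adm₀ A) (hI : Inner₀ t A) {a : EuclideanSpace ℝ (Fin 3)} (ha : a ∈ Sites₀ t A)
    (ξ : EuclideanSpace ℝ (Fin 3)) {w : EuclideanSpace ℝ (Fin 3) → EuclideanSpace ℝ (Fin 3)}
    (hw : (Function.support w).Finite) :
    ∑' p : Sites₀ t A, ⟪(if (p : EuclideanSpace ℝ (Fin 3)) = a then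
        ∑' q : Sites₀ t A, (if (q : EuclideanSpace ℝ (Fin 3)) ≠ a then forceConst (a - q) ξ else 0)
      else -forceConst (a - p) ξ), w p⟫ =
      ∑' q : Sites₀ t A, (if (q : EuclideanSpace ℝ (Fin 3)) ≠ a then ⟪forceConst (a - q) ξ, w a - w q⟫ else 0) := by
  -- summability of the off-diagonal vector family
  have hR : Summable (fun q : Sites₀ t A => (if (q : EuclideanSpace ℝ (Fin 3)) ≠ a then forceConst (a - q) ξ else 0)) :=
    summable_offdiag hA hI ha ξ
  -- split the outer sum at `p = a`
  have hout : (fun p : Sites₀ t A => ⟪(if (p : EuclideanSpace ℝ (Fin 3)) = a then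
        ∑' q : Sites₀ t A, (if (q : EuclideanSpace ℝ (Fin 3)) ≠ a then forceConst (a - q) ξ else 0)
      else -forceConst (a - p) ξ), w p⟫) =
      fun p : Sites₀ t A => (if p = ⟨a, ha⟩ then ⟪∑' q : Sites₀ t A,
          (if (q : EuclideanSpace ℝ (Fin 3)) ≠ a then forceConst (a - q) ξ else 0), w a⟫ else 0) +
        (if (p : EuclideanSpace ℝ (Fin 3)) ≠ a then -⟪forceConst (a - p) ξ, w p⟫ else 0) := by
    funext p
    by_cases hp : p = ⟨a, ha⟩
    · have hp' : (p : EuclideanSpace ℝ (Fin 3)) = a := by rw [hp]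
      rw [if_pos hp', if_pos hp, if_neg (not_not.2 hp'), add_zero, hp']
    · have hp' : (p : EuclideanSpace ℝ (Fin 3)) ≠ a := fun h => hp (Subtype.ext h)
      rw [if_neg hp', if_neg hp, if_pos hp', zero_add, inner_neg_left]
  have hcol : Summable (fun p : Sites₀ t A => (if (p : EuclideanSpace ℝ (Fin 3)) ≠ a then -⟪forceConst (a - p) ξ, w p⟫ else 0)) := by
    refine summable_of_hasFiniteSupport ((hw.preimage Subtype.val_injective.injOn).subset ?_)
    intro p hp
    simp only [Function.mem_support, ne_eq] at hp ⊢
    intro h0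
    apply hp
    simp [h0]
  have hX : Summable (fun p : Sites₀ t A => (if p = ⟨a, ha⟩ then ⟪∑' q : Sites₀ t A,
      (if (q : EuclideanSpace ℝ (Fin 3)) ≠ a then forceConst (a - q) ξ else 0), w a⟫ else (0 : ℝ))) :=
    (hasSum_ite_eq _ _).summable
  rw [hout, hX.tsum_add hcol, tsum_ite_eq]
  -- the inner product with the convergent vector sum
  have hinner : ⟪∑' q : Sites₀ t A, (if (q : EuclideanSpace ℝ (Fin 3)) ≠ a then forceConst (a - q) ξ else 0), w a⟫ =
      ∑' q : Sites₀ t A, (if (q : EuclideanSpace ℝ (Fin 3)) ≠ a then ⟪forceConst (a - q) ξ, w a⟫ else 0) := by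
    rw [real_inner_comm, ← innerSL_apply_apply (𝕜 := ℝ), ContinuousLinearMap.map_tsum (innerSL ℝ (w a)) hR]
    refine tsum_congr fun q => ?_
    by_cases hq : (q : EuclideanSpace ℝ (Fin 3)) ≠ a
    · rw [if_pos hq, if_pos hq, innerSL_apply_apply, real_inner_comm]
    · rw [if_neg hq, if_neg hq, map_zero]
  have hX' : Summable (fun q : Sites₀ t A => (if (q : EuclideanSpace ℝ (Fin 3)) ≠ a then ⟪forceConst (a - q) ξ, w a⟫ else 0)) := by
    have h := hR.mapL (innerSL ℝ (w a))
    refine h.congr fun q => ?_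
    by_cases hq : (q : EuclideanSpace ℝ (Fin 3)) ≠ a
    · simp only [if_pos hq, innerSL_apply_apply, real_inner_comm]
    · simp only [if_neg hq, map_zero]
  rw [hinner, ← hX'.tsum_add hcol]
  refine tsum_congr fun q => ?_
  by_cases hq : (q : EuclideanSpace ℝ (Fin 3)) ≠ a
  · rw [if_pos hq, if_pos hq, if_pos hq, inner_sub_right]; ring
  · rw [if_neg hq, if_neg hq, if_neg hq, add_zero]

/-- **`L(δ_a ξ)` is an admissible right-hand side**: under the path bound with constant `C₀`, its pairing with any
finitely supported test field is bounded by `(76 · 1024/(23/25)⁸ · C₀ ‖ξ‖) · √(nnForm w)` (crudely). [folklore] -/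
theorem single_rows_adm (hA : Adm₀ A) (hI : Inner₀ t A) {C₀ : ℝ} (hC₀ : 0 ≤ C₀)
    (hpath : ∀ w : EuclideanSpace ℝ (Fin 3) → EuclideanSpace ℝ (Fin 3), (Function.support w).Finite →
      Function.support w ⊆ Sites₀ t A → ∀ p ∈ Sites₀ t A, ∀ q ∈ Sites₀ t A,
        ‖w p - w q‖ ≤ C₀ * (1 + dist p q) * Real.sqrt (nnForm t A w))
    {a : EuclideanSpace ℝ (Fin 3)} (ha : a ∈ Sites₀ t A) (ξ : EuclideanSpace ℝ (Fin 3)) :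
    ∀ w : EuclideanSpace ℝ (Fin 3) → EuclideanSpace ℝ (Fin 3), (Function.support w).Finite →
      Function.support w ⊆ Sites₀ t A →
        |∑' p : Sites₀ t A, ⟪(fun x : EuclideanSpace ℝ (Fin 3) => if x = a then
            ∑' q : Sites₀ t A, (if (q : EuclideanSpace ℝ (Fin 3)) ≠ a then forceConst (a - q) ξ else 0)
          else -forceConst (a - x) ξ) p, w p⟫| ≤
          (38 * (1024 / ((23 / 25 : ℝ) ^ 3 * (23 / 25 : ℝ) ^ 5) + 1024 / ((23 / 25 : ℝ) ^ 3 * (23 / 25 : ℝ) ^ 4)) * C₀ * ‖ξ‖) *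
            Real.sqrt (nnForm t A w) := by
  intro w hw hwS
  rw [show (fun p : Sites₀ t A => ⟪(fun x : EuclideanSpace ℝ (Fin 3) => if x = a then
      ∑' q : Sites₀ t A, (if (q : EuclideanSpace ℝ (Fin 3)) ≠ a then forceConst (a - q) ξ else 0)
      else -forceConst (a - x) ξ) p, w p⟫) = fun p : Sites₀ t A => ⟪(if (p : EuclideanSpace ℝ (Fin 3)) = a then
      ∑' q : Sites₀ t A, (if (q : EuclideanSpace ℝ (Fin 3)) ≠ a then forceConst (a - q) ξ else 0)
      else -forceConst (a - p) ξ), w p⟫ from rfl]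
  rw [single_rows_pairing hA hI ha ξ hw]
  obtain ⟨hks, hkle⟩ := tsum_ker_weight_le hA hI ha
  set M : ℝ := Real.sqrt (nnForm t A w) with hM
  have hM0 : 0 ≤ M := Real.sqrt_nonneg _
  have hterm : ∀ q : Sites₀ t A, ‖(if (q : EuclideanSpace ℝ (Fin 3)) ≠ a then ⟪forceConst (a - q) ξ, w a - w q⟫ else 0)‖ ≤
      38 * C₀ * ‖ξ‖ * M * (if (q : EuclideanSpace ℝ (Fin 3)) ≠ a then
        (dist (q : EuclideanSpace ℝ (Fin 3)) a)⁻¹ ^ 8 * (1 + dist a (q : EuclideanSpace ℝ (Fin 3))) else 0) := by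
    intro q
    by_cases hq : (q : EuclideanSpace ℝ (Fin 3)) ≠ a
    · rw [if_pos hq, if_pos hq, Real.norm_eq_abs]
      have he : 9 / 10 ≤ ‖a - q‖ := by
        have := dist_sites_ge hA hI ha q.2 (Ne.symm hq); rw [dist_eq_norm] at this; linarith
      have h1 := norm_forceConst_apply_le' he ξ
      have h2 := hpath w hw hwS a ha q q.2
      have hd : ‖a - (q : EuclideanSpace ℝ (Fin 3))‖ = dist (q : EuclideanSpace ℝ (Fin 3)) a := by rw [dist_comm, dist_eq_norm]
      rw [hd] at h1
      calc |⟪forceConst (a - q) ξ, w a - w q⟫| ≤ ‖forceConst (a - q) ξ‖ * ‖w a - w q‖ := abs_real_inner_le_norm _ _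
        _ ≤ (38 * ((dist (q : EuclideanSpace ℝ (Fin 3)) a)⁻¹) ^ 8 * ‖ξ‖) * (C₀ * (1 + dist a q) * M) :=
            mul_le_mul h1 h2 (norm_nonneg _) (by positivity)
        _ = 38 * C₀ * ‖ξ‖ * M * ((dist (q : EuclideanSpace ℝ (Fin 3)) a)⁻¹ ^ 8 * (1 + dist a (q : EuclideanSpace ℝ (Fin 3)))) := by ring
    · rw [if_neg hq, if_neg hq, norm_zero, mul_zero]
  calc |∑' q : Sites₀ t A, (if (q : EuclideanSpace ℝ (Fin 3)) ≠ a then ⟪forceConst (a - q) ξ, w a - w q⟫ else 0)|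
      = ‖∑' q : Sites₀ t A, (if (q : EuclideanSpace ℝ (Fin 3)) ≠ a then ⟪forceConst (a - q) ξ, w a - w q⟫ else 0)‖ :=
        (Real.norm_eq_abs _).symm
    _ ≤ ∑' q : Sites₀ t A, 38 * C₀ * ‖ξ‖ * M * (if (q : EuclideanSpace ℝ (Fin 3)) ≠ a then
        (dist (q : EuclideanSpace ℝ (Fin 3)) a)⁻¹ ^ 8 * (1 + dist a (q : EuclideanSpace ℝ (Fin 3))) else 0) :=
        tsum_of_norm_bounded (hks.mul_left _).hasSum hterm
    _ = 38 * C₀ * ‖ξ‖ * M * ∑' q : Sites₀ t A, (if (q : EuclideanSpace ℝ (Fin 3)) ≠ a then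
        (dist (q : EuclideanSpace ℝ (Fin 3)) a)⁻¹ ^ 8 * (1 + dist a (q : EuclideanSpace ℝ (Fin 3))) else 0) := tsum_mul_left
    _ ≤ 38 * C₀ * ‖ξ‖ * M * (1024 / ((23 / 25 : ℝ) ^ 3 * (23 / 25 : ℝ) ^ 5) + 1024 / ((23 / 25 : ℝ) ^ 3 * (23 / 25 : ℝ) ^ 4)) :=
        mul_le_mul_of_nonneg_left hkle (by positivity)
    _ = _ := by ring

/-! ## The dipole decomposition of `L(δ_a ξ)` -/

/-- **Dipole decomposition**: pointwise on the sites, `L(δ_a ξ) = Σ_q (δ_a − δ_q)(K(a−q) ξ)` (`HasSum` over `q ∈ S`).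
[folklore] -/
theorem single_rows_dipoles (hA : Adm₀ A) (hI : Inner₀ t A) {a : EuclideanSpace ℝ (Fin 3)} (ha : a ∈ Sites₀ t A)
    (ξ : EuclideanSpace ℝ (Fin 3)) {x : EuclideanSpace ℝ (Fin 3)} (hx : x ∈ Sites₀ t A) :
    HasSum (fun q : Sites₀ t A => (fun y : EuclideanSpace ℝ (Fin 3) =>
        (if y = a then forceConst (a - q) ξ else 0) - (if y = q then forceConst (a - q) ξ else 0)) x)
      ((fun y : EuclideanSpace ℝ (Fin 3) => if y = a then
          ∑' q : Sites₀ t A, (if (q : EuclideanSpace ℝ (Fin 3)) ≠ a then forceConst (a - q) ξ else 0)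
        else -forceConst (a - y) ξ) x) := by
  by_cases hxa : x = a
  · have hR := (summable_offdiag hA hI ha ξ).hasSum
    have hfun : (fun q : Sites₀ t A => (fun y : EuclideanSpace ℝ (Fin 3) =>
        (if y = a then forceConst (a - q) ξ else 0) - (if y = q then forceConst (a - q) ξ else 0)) x) =
        fun q : Sites₀ t A => (if (q : EuclideanSpace ℝ (Fin 3)) ≠ a then forceConst (a - q) ξ else 0) := by
      funext q
      simp only [hxa, if_true]
      by_cases hq : (q : EuclideanSpace ℝ (Fin 3)) = a
      · rw [if_pos hq.symm, if_neg (not_not.2 hq), hq, sub_self]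
      · rw [if_neg (Ne.symm hq), if_pos hq, sub_zero]
    have hval : (fun y : EuclideanSpace ℝ (Fin 3) => if y = a then
          ∑' q : Sites₀ t A, (if (q : EuclideanSpace ℝ (Fin 3)) ≠ a then forceConst (a - q) ξ else 0)
        else -forceConst (a - y) ξ) x =
        ∑' q : Sites₀ t A, (if (q : EuclideanSpace ℝ (Fin 3)) ≠ a then forceConst (a - q) ξ else 0) := by
      simp only [hxa, if_true]
    rw [hfun, hval]
    exact hR
  · have hfun : (fun q : Sites₀ t A => (fun y : EuclideanSpace ℝ (Fin 3) =>
        (if y = a then forceConst (a - q) ξ else 0) - (if y = q then forceConst (a - q) ξ else 0)) x) =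
        fun q : Sites₀ t A => (if q = ⟨x, hx⟩ then -forceConst (a - x) ξ else 0) := by
      funext q
      simp only [if_neg hxa, zero_sub]
      by_cases hq : q = ⟨x, hx⟩
      · rw [if_pos hq, hq, if_pos rfl]
      · have hq' : x ≠ (q : EuclideanSpace ℝ (Fin 3)) := fun h => hq (Subtype.ext h.symm)
        rw [if_neg hq, if_neg hq', neg_zero]
    have hval : (fun y : EuclideanSpace ℝ (Fin 3) => if y = a then
          ∑' q : Sites₀ t A, (if (q : EuclideanSpace ℝ (Fin 3)) ≠ a then forceConst (a - q) ξ else 0)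
        else -forceConst (a - y) ξ) x = -forceConst (a - x) ξ := by
      simp only [if_neg hxa]
    rw [hfun, hval]
    exact hasSum_ite_eq _ _

/-- The dipole bounds `N_q = C₀ (1 + dist a q) ‖K(a−q) ξ‖` are summable, with an explicit bound. [folklore] -/
theorem summable_dipole_bounds (hA : Adm₀ A) (hI : Inner₀ t A) {C₀ : ℝ} (hC₀ : 0 ≤ C₀) {a : EuclideanSpace ℝ (Fin 3)}
    (ha : a ∈ Sites₀ t A) (ξ : EuclideanSpace ℝ (Fin 3)) :
    Summable (fun q : Sites₀ t A => C₀ * (1 + dist a (q : EuclideanSpace ℝ (Fin 3))) * ‖forceConst (a - q) ξ‖) ∧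
      ∑' q : Sites₀ t A, C₀ * (1 + dist a (q : EuclideanSpace ℝ (Fin 3))) * ‖forceConst (a - q) ξ‖ ≤
        38 * C₀ * ‖ξ‖ * (1024 / ((23 / 25 : ℝ) ^ 3 * (23 / 25 : ℝ) ^ 5) + 1024 / ((23 / 25 : ℝ) ^ 3 * (23 / 25 : ℝ) ^ 4)) := by
  obtain ⟨hks, hkle⟩ := tsum_ker_weight_le hA hI ha
  have hle : ∀ q : Sites₀ t A, C₀ * (1 + dist a (q : EuclideanSpace ℝ (Fin 3))) * ‖forceConst (a - q) ξ‖ ≤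
      38 * C₀ * ‖ξ‖ * (if (q : EuclideanSpace ℝ (Fin 3)) ≠ a then
        (dist (q : EuclideanSpace ℝ (Fin 3)) a)⁻¹ ^ 8 * (1 + dist a (q : EuclideanSpace ℝ (Fin 3))) else 0) := by
    intro q
    by_cases hq : (q : EuclideanSpace ℝ (Fin 3)) ≠ a
    · rw [if_pos hq]
      have he : 9 / 10 ≤ ‖a - q‖ := by
        have := dist_sites_ge hA hI ha q.2 (Ne.symm hq); rw [dist_eq_norm] at this; linarith
      have h1 := norm_forceConst_apply_le' he ξ
      have hd : ‖a - (q : EuclideanSpace ℝ (Fin 3))‖ = dist (q : EuclideanSpace ℝ (Fin 3)) a := by rw [dist_comm, dist_eq_norm]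
      rw [hd] at h1
      calc C₀ * (1 + dist a (q : EuclideanSpace ℝ (Fin 3))) * ‖forceConst (a - q) ξ‖
          ≤ C₀ * (1 + dist a (q : EuclideanSpace ℝ (Fin 3))) * (38 * ((dist (q : EuclideanSpace ℝ (Fin 3)) a)⁻¹) ^ 8 * ‖ξ‖) :=
            mul_le_mul_of_nonneg_left h1 (by positivity)
        _ = _ := by ring
    · rw [not_not] at hq
      rw [if_neg (not_not.2 hq), hq, sub_self, forceConst_zero]
      simp
  have hnn : ∀ q : Sites₀ t A, 0 ≤ C₀ * (1 + dist a (q : EuclideanSpace ℝ (Fin 3))) * ‖forceConst (a - q) ξ‖ :=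
    fun q => by positivity
  have hs : Summable (fun q : Sites₀ t A => C₀ * (1 + dist a (q : EuclideanSpace ℝ (Fin 3))) * ‖forceConst (a - q) ξ‖) :=
    Summable.of_nonneg_of_le hnn hle (hks.mul_left _)
  refine ⟨hs, (hs.tsum_le_tsum hle (hks.mul_left _)).trans ?_⟩
  rw [tsum_mul_left]
  exact mul_le_mul_of_nonneg_left hkle (by positivity)


/-- Registered sub-goal carrying this file (crux stmt-AtomisticToContinuum-9332, line `Sketch` v4, part H3d-I of
`stub_green`): the pairing of `L(δ_a ξ)` with a finitely supported test field. [folklore] -/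
theorem _root_.Summit.AtomisticToContinuum.Crystallization.Theorems.ExcessDecayLiouville.blowdown_singleRows :
    ∀ (t : Fin 2 → EuclideanSpace ℝ (Fin 3)) (A : EuclideanSpace ℝ (Fin 3) →L[ℝ] EuclideanSpace ℝ (Fin 3)), Adm₀ A → Inner₀ t A → ∀ (a : EuclideanSpace ℝ (Fin 3)), a ∈ Sites₀ t A → ∀ (ξ : EuclideanSpace ℝ (Fin 3)) (w : EuclideanSpace ℝ (Fin 3) → EuclideanSpace ℝ (Fin 3)), (Function.support w).Finite → ∑' p : Sites₀ t A, ⟪(if (p : EuclideanSpace ℝ (Fin 3)) = a then ∑' q : Sites₀ t A, (if (q : EuclideanSpace ℝ (Fin 3)) ≠ a then forceConst (a - q) ξ else 0) else -forceConst (a - p) ξ), w p⟫ = ∑' q : Sites₀ t A, (if (q : EuclideanSpace ℝ (Fin 3)) ≠ a then ⟪forceConst (a - q) ξ, w a - w q⟫ else 0) :=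
  fun _ _ hA hI _ ha ξ _ hw => single_rows_pairing hA hI ha ξ hw

end

end Blowdown

end Summit.AtomisticToContinuum.Crystallization.Theorems.ExcessDecayLiouville

end
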